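import Mathlib
import HarnessLib
import HarnessLib.Audit
import Summits.AtomisticToContinuum.Statement
import Literature.MathematicalPhysics.QuantumManyBody.PeriodicBoseGas

/-!
Route: BECAmplitudeHierarchy

CLOSED (retired) 2026-08-15T13:38:29Z by operator:999:1257524 — reason: not-a-thesis: assembly does not conclude the sub-problem Statement — note: D-0027 §2.1 audit (human 2026-08-15: routes that do not decide the summit are removed): the assembly concludes `Literature.MathematicalPhysics.QuantumManyBody.BoseGas.BoseEinsteinCondensation`, not the sub-problem statement; a NEW conforming route may be opened from the same idea (generated `closes . The file is kept as the record of this route; refuted decls are indexed as negative knowledge (`ledger negatives`).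

# Route BECAmplitudeHierarchy — Lieb's amplitude gas un-closed — a linear pair-kernel hierarchy
around the CJL solution bounds the pinned slope, hence torus BEC; dense first

It suffices to show X = PinnedSlopeBound ∧ SlopeToCondensation ∧ BoundaryTransferWeak (card
lieb-amplitude-hierarchy-unclosed). PinnedSlopeBound is the OUTPUT node of Lieb's amplitude-gas
programme: for every repulsive finite-range v there are C, ρ₀ such that for 0 < ρ < ρ₀, all large N
and EVERY μ > 0 the pinned torus energy E^(μ)(N,L) := inf_Ψ [⟨Ψ,HΨ⟩ + μ(N − ⟨Ψ,n₀Ψ⟩)] (periodic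
trial states on the torus of side L = (N/ρ)^(1/3); n₀ = Σ_j P_j the constant-mode number; this is
CJL's H^(μ) = H + μΣ_j(1 − P_j)) satisfies E^(μ) ≤ E₀^per + μ·C√(ρa³)·N — by concavity in μ this
says, variationally and without eigenfunctions, that the torus GROUND STATE has depletion ≤ C√(ρa³)N
(Bogoliubov/CJL rate 8/(3√π)). SlopeToCondensation is the fixed-N Hellmann–Feynman transfer: at low
density, eventually in N, a slope bound ∀μ>0 with slope η ≥ 0 forces every δ-near-minimiser of the
periodic energy to have ⟨Ψ,n₀Ψ⟩ ≥ (1 − η − ε)N. BoundaryTransferWeak (shared verbatim with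
BECPeriodicReduction, stmt-AtomisticToContinuum-0827) turns periodic constant-mode BEC into the
conjunct's Dirichlet HasGroundStateBEC. The route's real content sits behind PinnedSlopeBound: the
mechanism cruxes AmplitudeClustering (#2) and HierarchyContraction (#3) (informal at open, filed
immediately; typed once the definition requests land), the typed support AmplitudeEnergyIdentity
(energy = pair-energy of the amplitude gas, pin invisible), and the dense-first calibration crux
HighDensityCondensation (#5).
Lean: `(∀ v : ℝ → ENNReal,
Literature.MathematicalPhysics.QuantumManyBody.BoseGas.IsRepulsiveFiniteRange v → ∃ C ρ₀ : ℝ, 0 < ρ₀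
∧ ∀ ρ : ℝ, 0 < ρ → ρ < ρ₀ → ∀ᶠ N : ℕ in Filter.atTop, ∀ μ : ℝ, 0 < μ → (⨅ Ψ :
Literature.MathematicalPhysics.QuantumManyBody.BoseGas.PeriodicTrialState N
(Literature.MathematicalPhysics.QuantumManyBody.BoseGas.sideLength ρ N),
Literature.MathematicalPhysics.QuantumManyBody.BoseGas.periodicEnergy v Ψ + ENNReal.ofReal μ * ((N :
ENNReal) - Literature.MathematicalPhysics.QuantumManyBody.BoseGas.condensateOccupation N
(Literature.MathematicalPhysics.QuantumManyBody.BoseGas.sideLength ρ N) Ψ.ψ)) ≤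
Literature.MathematicalPhysics.QuantumManyBody.BoseGas.periodicGroundStateEnergy v N
(Literature.MathematicalPhysics.QuantumManyBody.BoseGas.sideLength ρ N) + ENNReal.ofReal (μ * (C *
Real.sqrt (ρ * (Literature.MathematicalPhysics.QuantumManyBody.BoseGas.scatteringLength v).toReal ^
3)) * N)) ∧ (∀ v : ℝ → ENNReal,
Literature.MathematicalPhysics.QuantumManyBody.BoseGas.IsRepulsiveFiniteRange v → ∃ ρ₁ : ℝ, 0 < ρ₁ ∧
∀ ρ : ℝ, 0 < ρ → ρ < ρ₁ → ∀ᶠ N : ℕ in Filter.atTop, ∀ η : ℝ, 0 ≤ η → (∀ μ : ℝ, 0 < μ → (⨅ Ψ :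
Literature.MathematicalPhysics.QuantumManyBody.BoseGas.PeriodicTrialState N
(Literature.MathematicalPhysics.QuantumManyBody.BoseGas.sideLength ρ N),
Literature.MathematicalPhysics.QuantumManyBody.BoseGas.periodicEnergy v Ψ + ENNReal.ofReal μ * ((N :
ENNReal) - Literature.MathematicalPhysics.QuantumManyBody.BoseGas.condensateOccupation N
(Literature.MathematicalPhysics.QuantumManyBody.BoseGas.sideLength ρ N) Ψ.ψ)) ≤
Literature.MathematicalPhysics.QuantumManyBody.BoseGas.periodicGroundStateEnergy v N
(Literature.MathematicalPhysics.QuantumManyBody.BoseGas.sideLength ρ N) + ENNReal.ofReal (μ * η *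
N)) → ∀ ε : ℝ, 0 < ε → ∃ δ : ENNReal, 0 < δ ∧ ∀ Ψ :
Literature.MathematicalPhysics.QuantumManyBody.BoseGas.PeriodicTrialState N
(Literature.MathematicalPhysics.QuantumManyBody.BoseGas.sideLength ρ N),
Literature.MathematicalPhysics.QuantumManyBody.BoseGas.periodicEnergy v Ψ ≤
Literature.MathematicalPhysics.QuantumManyBody.BoseGas.periodicGroundStateEnergy v N
(Literature.MathematicalPhysics.QuantumManyBody.BoseGas.sideLength ρ N) + δ → ENNReal.ofReal ((1 - η
- ε) * N) ≤ Literature.MathematicalPhysics.QuantumManyBody.BoseGas.condensateOccupation N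
(Literature.MathematicalPhysics.QuantumManyBody.BoseGas.sideLength ρ N) Ψ.ψ) ∧ (∀ v : ℝ → ENNReal,
Literature.MathematicalPhysics.QuantumManyBody.BoseGas.IsRepulsiveFiniteRange v → (∃ ρ₀ : ℝ, 0 < ρ₀
∧ ∀ ρ : ℝ, 0 < ρ → ρ < ρ₀ → ∃ c : ℝ, 0 < c ∧ ∀ᶠ N : ℕ in Filter.atTop, ∃ δ : ENNReal, 0 < δ ∧ ∀ Ψ :
Literature.MathematicalPhysics.QuantumManyBody.BoseGas.PeriodicTrialState N
(Literature.MathematicalPhysics.QuantumManyBody.BoseGas.sideLength ρ N),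
Literature.MathematicalPhysics.QuantumManyBody.BoseGas.periodicEnergy v Ψ ≤
Literature.MathematicalPhysics.QuantumManyBody.BoseGas.periodicGroundStateEnergy v N
(Literature.MathematicalPhysics.QuantumManyBody.BoseGas.sideLength ρ N) + δ → ENNReal.ofReal (c * N)
≤ Literature.MathematicalPhysics.QuantumManyBody.BoseGas.condensateOccupation N
(Literature.MathematicalPhysics.QuantumManyBody.BoseGas.sideLength ρ N) Ψ.ψ) → ∃ ρ₀ : ℝ, 0 < ρ₀ ∧ ∀
ρ : ℝ, 0 < ρ → ρ < ρ₀ → Literature.MathematicalPhysics.QuantumManyBody.BoseGas.HasGroundStateBEC v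
ρ)`

## Assembly
Fix v. PinnedSlopeBound gives C, ρ₀; SlopeToCondensation gives ρ₁; put ρ⋆ := (4C)⁻²a⁻³ if C, a > 0
(else 1) so that η := max(C√(ρa³), 0) ∈ [0, 1/4] for ρ < ρ⋆. For ρ < min(ρ₀, ρ₁, ρ⋆), eventually in
N (both filters), the slope hypothesis of SlopeToCondensation holds with this η (PinnedSlopeBound's
ENNReal.ofReal(μ·C√(ρa³)·N) ≤ ENNReal.ofReal(μ·η·N) by monotonicity); with ε = 1/4 it yields δ with
condensateOccupation ≥ (1 − η − 1/4)N ≥ N/2 for all periodic δ-near-minimisers — the periodic-BEC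
body with c = 1/2 — and BoundaryTransferWeak turns that into ∃ρ₀″ ∀ρ < ρ₀″ HasGroundStateBEC v ρ,
i.e. the conjunct for v. Pure logic plus real arithmetic (ofReal monotonicity, sqrt), checked
sorry-free in the planner's private sketch; the proof is the prover's to file.

Rationale: WHY THIS LINE. Integrate the Schrödinger equation instead of squaring it (Lieb1963; Jauslin2025
§4.2): since ψ₀ ≥ 0, ν_N = ψ₀/∫ψ₀ is a probability measure on the torus whose correlation functions
g_p obey an EXACT LINEAR hierarchy with the bare pair potential as its only kernel (Jauslin2025
(4.10)), the energy is the pair-energy of ν with no kinetic term (E₀/N = ((N−1)/2V)∫v g₂,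
Jauslin2025 (4.6)), and the CJL pinning term μΣ_j(1 − P_j) closes DOWNWARD, so the depletion η =
∂_μe_μ at 0⁺ (CarlenJauslinLieb2021 (FH) and Thm 6) is a functional of the un-closed hierarchy. Lieb
CLOSED the hierarchy by superposition (Jauslin2025 Assumption 4.1) and Carlen–Jauslin–Lieb proved
that the closed simple equation has a unique solution with the LHY energy, the mean-field energy at
high density for positive-type v, u ≍ |x|⁻⁴ and η ~ 8√(ρa³)/(3√π) (CarlenJauslinLieb2020 Thms 1–3;
CarlenJauslinLieb2021 Thms 2, 3, 6), writing that validity of the closure "would imply the existence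
of a Bose-Einstein condensate in the thermodynamic limit"; Jauslin2025 §8.1 names bounding g₃, g₄
minus their factorised counterparts as the open problem. This route does not prove factorisation a
priori: it treats the un-closed PINNED hierarchy as a linear fixed-point problem for the truncated
correlations around the CJL solution, driven by CJL's already-inverted massless operator 𝔎_e —
importing Kirkwood–Salsburg / Ruelle1969 Banach fixed-point technology for linear hierarchies from
classical statistical mechanics, and the diagnosis that the closure error is a truncated correlation
of a temperature-2 Riesz-2 gas with r⁻⁴ tails (CarlenJauslinLieb2021 Thm 2) — and it starts at HIGH
density for bounded positive-type v, where the Born approximation, the closure and CJL's e are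
simultaneously asymptotically exact (Lieb1963; CarlenJauslinLieb2020 Thm 2; GiulianiSeiringer2009 is
the only theorem on that axis, energy only). Versus prior routes: no plane-wave infrared bound
(BECInfraredBound), no κ/L² pinned-energy comparison (BECPinning: here μ is O(1) and only the slope
at 0⁺ is used, isolated in SlopeToCondensation), no RG (BECRenormGroup), no Born-measure landscape
(BECPalmLandscape); it plugs into BECPeriodicReduction through the shared BoundaryTransferWeak.
Negatives index: empty (2026-08-15).

RANKED CRUXES. Ranks 2 and 3 are the mechanism's own cruxes; they cannot be typed before the
definition requests land (Lieb's amplitude correlation functions g_p; the CJL simple-equation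
objects) and are filed INFORMAL immediately after open: #2 AmplitudeClustering — uniformly in N and
μ ∈ [0, μ₀], the closure defects of the level-2 equation, D₃ = ρΣ_i∫v(x_i−y)h₃ dy and D₄ =
(ρ²/2)∫∫v(y−y′)[h₄ − disconnected] (h₃ := g₃ − Kirkwood superposition, h₄ Lieb's level-4
truncation), are ≤ ε·(retained terms) with ε = O(√(ρa³)) (resp. O((ρR₀³)^(−1/2)) at high density) in
the weighted L¹∩L^∞ norms on which 𝔎_e acts (why it might fail: an infinite-volume
truncated-correlation decay statement for a long-range r⁻⁴-tailed effective gas, uniform in N,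
without a priori access to ψ₀; 3-body Beliaev/infrared physics lives in h₃; d = 1 closure error
19–69%, LiebLiniger1964; sources Lieb1963, Jauslin2025 §4.2.3 and §8.1, CarlenJauslinLieb2021 Thm 2,
CarlenEtAl2021). #3 HierarchyContraction — the exact linear pinned hierarchy, rewritten for the
truncated sequence (h_p)_(p≥3) around the CJL solution, has a unique solution in the clustering
class (growth condition in p, as activity bounds for Kirkwood–Salsburg), the true (g_p^(μ,N)) lie in
it as N → ∞, and the output is e_μ − e_0 ≤ μ(η_CJL(ρ) + Cε) for μ ∈ (0, μ₀] with η_CJL from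
CarlenJauslinLieb2021 Thm 6 (why it might fail: upward coupling by TWO levels with coefficients ρ,
ρ²/2 not small per se — smallness must come from the linked-cluster structure; the μ-slope, not the
value, must be controlled uniformly in N; CJL's L^p→L^q theory is proved for the SIMPLE equation, e
< e⋆ = √2π³/‖v‖₁², while the big/complete equation is not known to have solutions; sources
CarlenJauslinLieb2020 Thm 1, CarlenJauslinLieb2021 Thms 3, 6, Lemma 10, Jauslin2025 Thm 4.2,
Ruelle1969). Typed now:
#4 PinnedSlopeBound (crux) — (card C2 output node) for every repulsive finite-range radial v there
are C and ρ₀ > 0 such that for 0 < ρ < ρ₀, eventually in N, for every μ > 0: inf over periodic trial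
states Ψ on the torus of side L = (N/ρ)^(1/3) of [periodicEnergy v Ψ + μ(N − condensateOccupation
Ψ)] ≤ periodicGroundStateEnergy v N L + μ·C√(ρa³)·N, a = scatteringLength v. Equivalent by concavity
of μ ↦ E^(μ) to the same for μ ∈ (0, μ₀]; equivalent, given SlopeToCondensation's spectral input, to
ground-state depletion ≤ C√(ρa³)N. Expected C → 8/(3√π) = 1.5045 universally (Bogoliubov;
CarlenJauslinLieb2021 Thm 6). Sanity: v ≡ 0 gives 0 ≤ 0 (the constant state has condensateOccupation
exactly N). [deps: AmplitudeEnergyIdentity] [difficulty: open-problem] (why it might fail: it IS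
thermodynamic-limit ground-state BEC at Bogoliubov rate on the torus (open); the amplitude-gas route
to it needs #2 + #3, whose linked-cluster reorganisation may not converge (r⁻⁴ tails, marginal d = 3
infrared logs entering through h₃).) [CarlenJauslinLieb2021, CarlenJauslinLieb2020, Lieb1963,
Jauslin2025, LSSY2005, FournaisSolovej2020]
#5 HighDensityCondensation (crux) — (card target HighDensityTLBEC, the dense-first calibration rung;
deliberately outside the assembly) for every BOUNDED, POSITIVE-TYPE (Σ_(x,y∈s) w_x w_y v(|x−y|) ≥ 0
for all finite s ⊂ ℝ³ and real weights w), repulsive finite-range radial v there is ρ₁ such that for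
every ρ > ρ₁ there is c > 0 with: eventually in N there is δ > 0 such that every periodic trial
state on the torus of side (N/ρ)^(1/3) with periodicEnergy ≤ E₀^per + δ has condensateOccupation ≥
cN. This is the density axis on which the Born approximation (a ≈ a₀), Lieb's bounds ρv̂(0)/2 −
v(0)/2 ≤ e ≤ ρv̂(0)/2 and the CJL closure are simultaneously asymptotically exact, and where
Bogoliubov predicts a depletion FRACTION O(ρ^(−1/2)) → 0; class member: v = χ_B ∗ χ_B
(autocorrelation of a ball indicator: bounded, non-negative, finite range, positive type).
[difficulty: open-problem] (why it might fail: no TL-BEC theorem exists at ANY density; at fixed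
coupling ρξ³ = ρ^(−1/2)v̂(0)^(−3/2) → 0 (under one particle per healing volume), so Bogoliubov's
validity parameter fails even though ρ^(2/3) ≫ v(0) forbids a crystal; positive type is essential
(v̂(k₀) < 0: density wave).) [Lieb1963, CarlenJauslinLieb2020, GiulianiSeiringer2009, Seiringer2011,
CarlenEtAl2021, LSSY2005]
#6 SlopeToCondensation (crux) — (fixed-N Hellmann–Feynman transfer, card C3) for every repulsive
finite-range v there is ρ₁ > 0 such that for 0 < ρ < ρ₁, eventually in N, for every real η ≥ 0: if
for all μ > 0 the pinned infimum is ≤ E₀^per + μηN, then for every ε > 0 there is δ > 0 such that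
every periodic δ-near-minimiser has condensateOccupation ≥ (1 − η − ε)N. Proof shape: E₀^per < ⊤ at
low density (hard cores: symmetrised lattice trial state); H + μN₊ has compact resolvent and, for μ
≥ 0, a positivity-improving semigroup (e^(tμΣP_j) has a non-negative kernel), hence a unique
positive gapped ground state ψ₀; second-order perturbation E^(μ) ≥ E₀ + μ⟨N₊⟩₀ − c_N μ² gives ⟨N₊⟩₀
≤ ηN; near-minimisers are L²-close to ψ₀ by the gap and √occupation is √N-Lipschitz in L².
[difficulty: M] (why it might fail: v = ⊤ shells or hard cores disconnect configuration space; with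
a degenerate ground space ∂⁺_μE^(μ)(0) is the MINIMUM depletion over ground states, so the slope
certifies only the best ground state while near-minimisers reach the worst (low-density hard-sphere
connectivity is open).) [CarlenJauslinLieb2021, ReedSimonIV1978, BaryshnikovBubenikKahle2013,
LSSY2005]
#7 BoundaryTransferWeak (crux) — (shared verbatim with route BECPeriodicReduction,
stmt-AtomisticToContinuum-0827) for each repulsive finite-range v, periodic constant-mode BEC of
near-minimisers at all small densities implies ∃ρ₀ > 0 ∀ρ ∈ (0, ρ₀) HasGroundStateBEC v ρ (Dirichlet
box, mode-free λ_max criterion via condensateNumber). [difficulty: L] (why it might fail: the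
Dirichlet ground state lies a wall term ≫ the near-minimiser slack N/L² above E₀^per and interior
restrictions are neither periodic nor of sharp N, so the periodic hypothesis may never fire; only
the ENERGY transfer is in print (Robinson1976).) [LSSY2005, Robinson1976, BoccatoSeiringer2023,
Junge2026]
#9 AmplitudeEnergyIdentity (support) — (Lieb's starting identity, pinned version; card C3) for
bounded repulsive finite-range v, N, L > 0, μ ≥ 0 and ε > 0 there is δ > 0 such that every
NON-NEGATIVE periodic trial state Ψ that is a δ-near-minimiser of the pinned functional
periodicEnergy + μ(N − condensateOccupation) satisfies |E^(μ)(N,L)·∫_(cell^N)Ψ − ∫_(cell^N)(Σ_(i<j)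
v^per(x_i − x_j))Ψ| ≤ ε∫_(cell^N)Ψ (two ENNReal inequalities): the pinned energy is the pair-energy
of the amplitude gas, E^(μ)/N = ((N−1)/2V)∫v^per g₂^(μ), with NO kinetic and NO pinning term (⟨1,
Δψ⟩ = 0 on the torus and ⟨1, (1 − P_j)ψ⟩ = 0: the pin closes downward). Proof: uniqueness and
positivity of the pinned ground state for μ ≥ 0, L²-convergence of near-minimisers on the finite
cell, ⟨1, H^(μ)ψ₀⟩ = E^(μ)⟨1, ψ₀⟩ with v^per bounded. [difficulty: M] [Lieb1963, Jauslin2025,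
CarlenJauslinLieb2021, ReedSimonIV1978]

TWO-LAYER PLAN. Foreseen, nothing filed now: PinnedSlopeBound ⇐ HierarchyContraction →
AmplitudeEnergyIdentity → PinnedSlopeBound (glue: e_μ − e_0 read off g₂^(μ) − g₂^(0) through the
identity for bounded v; hard cores by monotone truncation v∧M ↑ v at fixed N, lim_M E^(μ)_(v∧M) =
E^(μ)_v); HierarchyContraction ⇐ AmplitudeClustering → LinearisedInvertibility (𝔎_(e,μ) on the
weighted space: CarlenJauslinLieb2021 Lemma 10 and the factorisation 𝔜_e =
(−Δ)^(−1/2)(−Δ+8e)^(−1/2)[I+𝔋_e]) → HierarchyContraction; HighDensityCondensation ⇐ HighDensitySlope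
(the PinnedSlopeBound analogue with rate C(ρR₀³)^(−1/2)) → SlopeToCondensationDense
(SlopeToCondensation without the low-density guard, bounded v, provable now) →
HighDensityCondensation; SlopeToCondensation ⇐ FiniteEnergyLowDensity →
UniqueGappedPinnedGroundState → SlopeToCondensation.

KILL CRITERIA. Flat-trial PIGS (end slice = ψ₀/∫ψ₀ exactly) at ρa³ ∈ {10⁻³, 10⁻²}, v = e^(−|x|): a
truncated 3-point function g₃/KSA − 1 = O(1) at separations ≍ ξ (instead of O(√(ρa³))) refutes
AmplitudeClustering — close `refuted:AmplitudeClustering` unless the defect is SIGNED (then pivot to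
a conditional one-sided route). A proof that CJL's η(ρ) (Thm 6) differs from the true depletion at
order √(ρa³) does not touch PinnedSlopeBound (∃C) but refutes HierarchyContraction(iii) as stated —
resplit with the big/complete equation in place of the simple one. ¬SlopeToCondensation through
degenerate torus ground states of an admissible v at arbitrarily low density breaks this frame and
every near-minimiser frame (conjunct-level) — pivot: bounded v plus a HardCoreTruncation item.
¬BoundaryTransferWeak kills the route (shared with BECPeriodicReduction), not the conjunct.
¬HighDensityCondensation (a density-wave or crystalline torus ground state for some bounded
positive-type v at high density) removes the calibration rung and the dense-first strategy; the
low-density line survives without its cheapest test. PeriodicBEC (stmt-AtomisticToContinuum-0826) or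
X_B1 proved elsewhere moots PinnedSlopeBound's role; the route then lives on only as
HighDensityCondensation.

NOT DECOMPOSED YET. The Banach space (weights (1+|x|/ξ)⁴-type, growth in p) — fixed only when #2/#3
are typed after the definition requests; the finite-N O(p/N) terms of the exact hierarchy versus the
infinite-volume operator; hard cores (monotone truncation; CarlenJauslinLieb2020 §6 remark on
hard-core components) and the E₀^per < ⊤ construction; the spectral package behind
SlopeToCondensation and AmplitudeEnergyIdentity (compact resolvent, Perron–Frobenius for H + μN₊,
first-order perturbation) — layer-2 children or `--supports` lemmas; the high-density slope
statement and its rate; the passage simple → big → complete equation inside HierarchyContraction;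
nothing on T > 0, and nothing on the Dirichlet box beyond BoundaryTransferWeak.

CHEAPEST FALSIFIER. (i) Lookup, done: is un-closed-hierarchy control or any TL-BEC-at-high-density
theorem in print? CarlenJauslinLieb2021 §1 ("never been proved in the thermodynamic limit for a
continuum system"), Jauslin2025 §8.1 (open), GiulianiSeiringer2009 (energy only, weak coupling) —
no. (ii) Consistency, done by hand: v ≡ 0 makes every typed item true with equality (E^(μ) = E₀ = 0
by the constant state, whose condensateOccupation is exactly N; SlopeToCondensation via the free gap
(2π/L)²); 1-D transplant (outside the typed d = 3 statement): LiebLiniger1964 found the closure's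
energy off by 19–69% — the mechanism fails exactly where there is no BEC. (iii) The decisive cheap
test, not runnable here (hub compute-free for this seat): flat-trial PIGS closure error g₃/KSA − 1
at ρa³ ∈ {10⁻³, 10⁻²} and ρR₀³ ∈ {10, 100} for v = e^(−|x|) (the CarlenEtAl2021 potential); O(1) at
r ≍ ξ retires the card.

NUMBERS. η_Bog = (8/(3√π))√(ρa³) = 1.5045√(ρa³) (CarlenJauslinLieb2021 Thm 6: the simple equation
reproduces it); e = 2πρa(1 + (128/(15√π))√(ρa³) + o) in CJL units −½Δ (CarlenJauslinLieb2020 Thm 2;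
FournaisSolovej2020, YauYin2009 for the gas), = 4πρa(…) in ours (e_ours(v) = 2e_CJL(v/2)); ρu(x) =
√(2+β)/(2π²√e)|x|⁻⁴ + R (CarlenJauslinLieb2021 Thm 2); monotonicity for e < e⋆ = √2π³/‖v‖₁² and ρ′ ≤
16/‖v‖₁ (Thm 3); ∫u = 1/ρ exactly (CJL-II (intu): "not a low-density model", Jauslin2025 §8.1); high
density: e = (ρ/2)∫v + o(ρ) (CarlenJauslinLieb2020 Thm 2) and Lieb1963's bounds ρv̂(0)/2 − v(0)/2 ≤
e ≤ ρv̂(0)/2 for positive-type v; closure numerics: energy within 5% of QMC at all densities for v =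
e^(−|x|) (CarlenJauslinLieb2020 §5.2, CarlenEtAl2021), 1-D 19–69% (LiebLiniger1964);
GiulianiSeiringer2009 Thm 1: LHY at a/R₀ = O(Y^(1/2−d)), d < 1/69, positive-definite v. Items at
open: 6 (4 typed cruxes incl. 1 shared, 1 support, 1 assembly) + 2 informal cruxes + 2 definition
requests filed right after.

DEFINITION REQUESTS. After open: (D1) `AmplitudeCorrelation` — Lieb's correlation functions
g_p^Ψ(x₁…x_p) := V^p ∫_(cell^(N−p)) Ψ / ∫_(cell^N) Ψ of a non-negative periodic N-body function,
marginal consistency (1/V)∫g_p dx_p = g_(p−1), and the truncations h₃ := g₃ − g₂g₂g₂, h₄ (Lieb1963;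
Jauslin2025 (4.9), (4.13)–(4.14)); topic Literature/MathematicalPhysics/QuantumManyBody; for
AmplitudeClustering. (D2) `LiebSimpleEquation` — the CJL objects: IsSimpleEquationSolution v ρ e u
((−Δ + 4e + v)u = v + 2eρ u∗u, 2e/ρ = ∫(1−u)v, u ∈ L¹, u ≤ 1), the density function ρ(e), the
operator 𝔎_e = (−Δ + v + 4e(1 − ρu∗))⁻¹, the pinned system (−Δ + 2μ + 4e_μ)u_μ = (1−u_μ)v + 2ρe_μ
u_μ∗u_μ and η := ∂_μe_μ at 0 (CarlenJauslinLieb2020 Thm 1; CarlenJauslinLieb2021 (simp),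
(simpleq_eta), Thm 6), with the unit map to ħ = 2m = 1; topic
Literature/MathematicalPhysics/QuantumManyBody; for HierarchyContraction. Cite facts wanted as
hypotheses: CarlenJauslinLieb2020 Thm 1 (existence/uniqueness) and Thm 2 (low/high-density
asymptotics); CarlenJauslinLieb2021 Thm 2 (|x|⁻⁴ decay), Thm 3 (monotonicity), Thm 6 (η formula and
asymptotics). No new notion is needed for the typed items (PeriodicTrialState, periodicEnergy,
periodicGroundStateEnergy, condensateOccupation, periodicInteraction, cellN, sideLength,
scatteringLength, HasGroundStateBEC, BoseEinsteinCondensation all exist in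
Literature.MathematicalPhysics.QuantumManyBody.BoseGas).

Novelty: Searches (2026-08-15): `lit frontier AtomisticToContinuum --since 2021` (30 rows; BEC descendants
arXiv:2603.20776, arXiv:2510.20493, arXiv:2602.16566 — none on the simplified approach); `lit
bridges AtomisticToContinuum --cross any` (no Bose-gas bridge); `lit citing arXiv:2010.13882` (7:
arXiv:2302.13446 = Jauslin2024, arXiv:2202.07637 = Jauslin2022, arXiv:2203.11917, arXiv:2002.04184);
`lit search --source crossref "simplified approach ground state energy imperfect Bose gas Lieb
1963"` (12: doi:10.1103/physrev.130.2518, doi:10.1103/physrev.133.a899,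
doi:10.1103/physrev.134.a312, doi:10.4171/90-1/25); `lit search --source crossref "BBGKY hierarchy
ground state wave function Bose fluid Kirkwood superposition"` (15: doi:10.1103/physrevb.14.3937
Miller 1976 and doi:10.1103/physreva.10.2378 Berdahl 1974 — Kirkwood-superposition BGY closures for
the BORN measure of helium, heuristic); `lit search --source zbmath "Bose Einstein condensation high
density thermodynamic limit interacting bosons"` (3: arXiv:2510.00839, arXiv:2308.00290,
arXiv:0711.1188) and `"high density Bose gas ground state energy Bogoliubov"` (4: arXiv:0811.1166);
`lit galaxy search --star all` ×2 (galaxyd queue saturated, rc 1 — recorded, no claim rests on it);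
OpenAlex and arXiv HTTP 429 in this pass; reads: arXiv:2010.13882 pp. 1–8, arXiv:1912.04987 pp. 4–5
and 12–13, arXiv:2308.00290 §4.2 and §8.1, arXiv:0811.1166 pp. 1–4; plus the card's refuter audit-12
(zbMATH/crossref, same nearest art).
Nearest prior art  [refs: 10.1103/physrev.130.2518, 10.1103/physrev.133.a899, 10.1103/physrev.134.a312, 10.4171/90-1/25, 10.1103/physrevb.14.3937, 10.1103/physreva.10.2378, 2603.20776, 2510.20493, 2602.16566, 2010.13882, 2302.13446, 2202.07637, 2203.11917, 2002.04184, 2510.00839, 2308.00290, 0711.1188, 0811.1166, 1912.04987, doi:10.1103/physrev.130.2518, doi:10.1103/physrev.133.a899, doi:10.1103/physrev.134.a312, doi:10.41]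

Barriers (technique_class: linear-hierarchy amplitude-measure fixed-point clustering): - technique_class: linear-hierarchy amplitude-measure fixed-point clustering
- Literature.Barriers.AtomisticToContinuum.EnergyAsymptoticsWithoutCondensation: evaded — no energy
asymptotics of e(ρ) are matched to infer BEC; the energy enters only as the μ-SLOPE of the pinned
family at 0⁺, which at finite N IS the depletion (SlopeToCondensation), and the 1-D witness is
respected (LiebLiniger1964: the closure fails by 19–69% exactly where there is no BEC).
- Literature.Barriers.AtomisticToContinuum.EnergyAsymptoticsWithoutCondensationNarrow: same; nothing
here uses LHY-precision VALUES of E₀.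
- Literature.Barriers.AtomisticToContinuum.SymmetryBreakingWithoutCondensate: respected — the pin
μΣ_j(1 − P_j) is number-conserving (no gauge-breaking source) and only the RIGHT derivative at μ =
0⁺ at finite N is used; the recorded pitfall is built into the statements: values of E^(μ) for μ ≥ 0
give only LOWER bounds on depletion by concavity, and the μ < 0 side is unstable beyond |μ| ≈
(2π/L)² (boosted condensate), so PinnedSlopeBound is a slope bound ∀μ > 0 and
HierarchyContraction(iii) is first-order in μ.
- Literature.Barriers.AtomisticToContinuum.SymmetryBreakingWithoutCondensateNarrow: cubes only (L =
(N/ρ)^(1/3)), canonical, T = 0 — outside the anisotropic-box witnesses.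
- Literature.Barriers.AtomisticToContinuum.BogoliubovPerturbationInfrared: not in its class at the
linear level — the massless linear-dispersion operator (symbol k² + 4e(1 − ρû(k)) ≍ c|k| + k²) is
INVERTED exactly

Novelty grade: new-combination — ROUTE-REVIEW (refuter, 2026-08-15) — route CLOSED(retired) by operator 13:38:29Z (D-0027 §2.1: assembly concludes Literature…BoseGas.BoseEinsteinCondensation instead of the root abbrev BoseEinsteinCondensation) during this review; items moot. Substantive findings for the conforming reopen: all 6 typ (refuter refuter-rreview-route-AtomisticToContinu-680f7413-0, 2026-08-15T13:57:33Z; prior: doi:10.1103/physrev.130.2518, arXiv:1912.04987, arXiv:2010.13882, arXiv:2308.00290)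

History (route lifecycle, newest last):
- 2026-08-15T13:38:29Z · CLOSED retired — not-a-thesis: assembly does not conclude the sub-problem Statement (operator:999:1257524)

sub-problem: BoseEinsteinCondensation · status: closed(retired) · opened planner-plancard-AtomisticToContinuum-BoseEin-43545e8e-0 2026-08-15T11:54:26Z · rev 1 · ledger route-AtomisticToContinuum-BECAmplitudeHierarchy
GENERATED by the gate from the ledger (D-0016/17). Provers cite these decls: `theorem foo : Summit.AtomisticToContinuum.BoseEinsteinCondensation.Theses.BECAmplitudeHierarchy.<Decl> := …` in Summits/AtomisticToContinuum/BoseEinsteinCondensation/Theorems/<Name>.lean.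
-/

namespace Summit.AtomisticToContinuum.BoseEinsteinCondensation.Theses.BECAmplitudeHierarchy

open scoped BigOperators Topology Manifold Classical MeasureTheory ProbabilityTheory Matrix InnerProductSpace ComplexConjugate ContinuousMap
open Filter Set Function TopologicalSpace MeasureTheory

attribute [summit_statement] _root_.BoseEinsteinCondensation

-- item stmt-AtomisticToContinuum-7127 · crux · rank 2 · closed · moot by None · by planner — informal only, no Lean statement yet:
--   [crux] AMPLITUDE-GAS CLUSTERING (card lieb-amplitude-hierarchy-unclosed item C1; rank 2; informal
--   until definition request AmplitudeCorrelation lands). Setting: v repulsive finite range with ∫v < ∞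
--   (bounded v first; hard cores by monotone truncation), 0 < ρ < ρ₀(v), torus of side L = (N/ρ)^{1/3},
--   μ ∈ [0, μ₀]; ψ^{(μ)} ≥ 0 the ground state of H + μΣ_j(1 − P_j) (H = −ΣΔ_i + Σ_{i<j}v^per(x_i − x_j),
--   ħ = 2m = 1, P_j = projection on the constant mode in x_j); amplitude gas ν = ψ/∫ψ with Lieb's
--   correlation functions g_p(x₁…x_p) = V^p ∫ψ dx_{p+1}…dx_N / ∫ψ (Lieb1963; Jauslin2025 (4.9)),
--   truncations h₃

-- item stmt-AtomisticToContinuum-7146 · crux · rank 3 · closed · moot by None · by planner — informal only, no Lean statement yet: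
--   [crux] UN-CLOSED PINNED HIERARCHY AS A CONTRACTION AROUND CJL (card item C2; rank 3; informal until
--   definition requests AmplitudeCorrelation and LiebSimpleEquation land). The exact linear pinned
--   hierarchy for the amplitude gas of H + μΣ_j(1 − P_j) — level p couples to p+1 and p+2 through the
--   pair kernels ρ∫v(x_i − y)· and (ρ²/2)∫∫v(y − y′)·, with the scalar side condition e_μ = (ρ/2)∫v
--   g₂^{(μ)} (AmplitudeEnergyIdentity) and the pin closing DOWNWARD (integrating μ(1 − P_j)ψ over
--   x_{p+1..N} gives μ[g_p − g_{p−1}^{(ĵ)}] for j ≤ p and 0 for j > p) — is rewritten for the truncated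
--   sequence (h_p)_{p

/-- item stmt-AtomisticToContinuum-6866 · crux · rank 4 · closed · moot by None · by planner
why it might fail: it IS thermodynamic-limit ground-state BEC at Bogoliubov rate on the torus (open); the amplitude-gas route to it needs #2 + #3, whose linked-cluster reorganisation may not converge (r⁻⁴ tails, marginal d = 3 infrared logs entering through h₃).
sources: CarlenJauslinLieb2021, CarlenJauslinLieb2020, Lieb1963, Jauslin2025, LSSY2005, FournaisSolovej2020
[crux] (card C2 output node) for every repulsive finite-range radial v there are C and ρ₀ > 0 such
that for 0 < ρ < ρ₀, eventually in N, for every μ > 0: inf over periodic trial states Ψ on the torus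
of side L = (N/ρ)^(1/3) of [periodicEnergy v Ψ + μ(N − condensateOccupation Ψ)] ≤
periodicGroundStateEnergy v N L + μ·C√(ρa³)·N, a = scatteringLength v. Equivalent by concavity of μ
↦ E^(μ) to the same for μ ∈ (0, μ₀]; equivalent, given SlopeToCondensation's spectral input, to
ground-state depletion ≤ C√(ρa³)N. Expected C → 8/(3√π) = 1.5045 universally (Bogoliubov;
CarlenJauslinLieb2021 Thm 6). Sanity: v ≡ 0 gives 0 ≤ 0 (the constant state has condensateOccupation
exactly N). [deps: AmplitudeEnergyIdentity] [difficulty: open-problem] -/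
@[route_item "route-AtomisticToContinuum-BECAmplitudeHierarchy"]
def PinnedSlopeBound : Prop :=
  ∀ v : ℝ → ENNReal, Literature.MathematicalPhysics.QuantumManyBody.BoseGas.IsRepulsiveFiniteRange v → ∃ C ρ₀ : ℝ, 0 < ρ₀ ∧ ∀ ρ : ℝ, 0 < ρ → ρ < ρ₀ → ∀ᶠ N : ℕ in Filter.atTop, ∀ μ : ℝ, 0 < μ → (⨅ Ψ : Literature.MathematicalPhysics.QuantumManyBody.BoseGas.PeriodicTrialState N (Literature.MathematicalPhysics.QuantumManyBody.BoseGas.sideLength ρ N), Literature.MathematicalPhysics.QuantumManyBody.BoseGas.periodicEnergy v Ψ + ENNReal.ofReal μ * ((N : ENNReal) - Literature.MathematicalPhysics.QuantumManyBody.BoseGas.condensateOccupation N (Literature.MathematicalPhysics.QuantumManyBody.BoseGas.sideLength ρ N) Ψ.ψ)) ≤ Literature.MathematicalPhysics.QuantumManyBody.BoseGas.periodicGroundStateEnergy v N (Literature.MathematicalPhysics.QuantumManyBody.BoseGas.sideLength ρ N) + ENNReal.ofReal (μ * (C * Real.sqrt (ρ * (Literature.MathematicalPhysics.QuantumManyBody.BoseGas.scatteringLength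 v).toReal ^ 3)) * N)

/-- item stmt-AtomisticToContinuum-6867 · crux · rank 5 · closed · moot by None · by planner
why it might fail: no TL-BEC theorem exists at ANY density; at fixed coupling ρξ³ = ρ^(−1/2)v̂(0)^(−3/2) → 0 (under one particle per healing volume), so Bogoliubov's validity parameter fails even though ρ^(2/3) ≫ v(0) forbids a crystal; positive type is essential (v̂(k₀) < 0: density wave).
sources: Lieb1963, CarlenJauslinLieb2020, GiulianiSeiringer2009, Seiringer2011, CarlenEtAl2021, LSSY2005
[crux] (card target HighDensityTLBEC, the dense-first calibration rung; deliberately outside the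
assembly) for every BOUNDED, POSITIVE-TYPE (Σ_(x,y∈s) w_x w_y v(|x−y|) ≥ 0 for all finite s ⊂ ℝ³ and
real weights w), repulsive finite-range radial v there is ρ₁ such that for every ρ > ρ₁ there is c >
0 with: eventually in N there is δ > 0 such that every periodic trial state on the torus of side
(N/ρ)^(1/3) with periodicEnergy ≤ E₀^per + δ has condensateOccupation ≥ cN. This is the density axis
on which the Born approximation (a ≈ a₀), Lieb's bounds ρv̂(0)/2 − v(0)/2 ≤ e ≤ ρv̂(0)/2 and the CJL
closure are simultaneously asymptotically exact, and where Bogoliubov predicts a depletion FRACTION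
O(ρ^(−1/2)) → 0; class member: v = χ_B ∗ χ_B (autocorrelation of a ball indicator: bounded,
non-negative, finite range, positive type). [difficulty: open-problem] -/
@[route_item "route-AtomisticToContinuum-BECAmplitudeHierarchy"]
def HighDensityCondensation : Prop :=
  ∀ v : ℝ → ENNReal, Literature.MathematicalPhysics.QuantumManyBody.BoseGas.IsRepulsiveFiniteRange v → (∃ M : NNReal, ∀ r : ℝ, v r ≤ (M : ENNReal)) → (∀ (s : Finset Literature.MathematicalPhysics.QuantumManyBody.BoseGas.Space) (w : Literature.MathematicalPhysics.QuantumManyBody.BoseGas.Space → ℝ), 0 ≤ ∑ x ∈ s, ∑ y ∈ s, w x * w y * (v (dist x y)).toReal) → ∃ ρ₁ : ℝ, 0 < ρ₁ ∧ ∀ ρ : ℝ, ρ₁ < ρ → ∃ c : ℝ, 0 < c ∧ ∀ᶠ N : ℕ in Filter.atTop, ∃ δ : ENNReal, 0 < δ ∧ ∀ Ψ : Literature.MathematicalPhysics.QuantumManyBody.BoseGas.PeriodicTrialState N (Literature.MathematicalPhysics.QuantumManyBody.BoseGas.sideLength ρ N), Literature.MathematicalPhysics.QuantumManyBody.BoseGas.periodicEnergy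 v Ψ ≤ Literature.MathematicalPhysics.QuantumManyBody.BoseGas.periodicGroundStateEnergy v N (Literature.MathematicalPhysics.QuantumManyBody.BoseGas.sideLength ρ N) + δ → ENNReal.ofReal (c * N) ≤ Literature.MathematicalPhysics.QuantumManyBody.BoseGas.condensateOccupation N (Literature.MathematicalPhysics.QuantumManyBody.BoseGas.sideLength ρ N) Ψ.ψ

/-- item stmt-AtomisticToContinuum-6868 · crux · rank 6 · closed · moot by None · by planner
why it might fail: v = ⊤ shells or hard cores disconnect configuration space; with a degenerate ground space ∂⁺_μE^(μ)(0) is the MINIMUM depletion over ground states, so the slope certifies only the best ground state while near-minimisers reach the worst (low-density hard-sphere connectivity is open).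
sources: CarlenJauslinLieb2021, ReedSimonIV1978, BaryshnikovBubenikKahle2013, LSSY2005
[crux] (fixed-N Hellmann–Feynman transfer, card C3) for every repulsive finite-range v there is ρ₁ >
0 such that for 0 < ρ < ρ₁, eventually in N, for every real η ≥ 0: if for all μ > 0 the pinned
infimum is ≤ E₀^per + μηN, then for every ε > 0 there is δ > 0 such that every periodic
δ-near-minimiser has condensateOccupation ≥ (1 − η − ε)N. Proof shape: E₀^per < ⊤ at low density
(hard cores: symmetrised lattice trial state); H + μN₊ has compact resolvent and, for μ ≥ 0, a
positivity-improving semigroup (e^(tμΣP_j) has a non-negative kernel), hence a unique positive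
gapped ground state ψ₀; second-order perturbation E^(μ) ≥ E₀ + μ⟨N₊⟩₀ − c_N μ² gives ⟨N₊⟩₀ ≤ ηN;
near-minimisers are L²-close to ψ₀ by the gap and √occupation is √N-Lipschitz in L². [difficulty: M] -/
@[route_item "route-AtomisticToContinuum-BECAmplitudeHierarchy"]
def SlopeToCondensation : Prop :=
  ∀ v : ℝ → ENNReal, Literature.MathematicalPhysics.QuantumManyBody.BoseGas.IsRepulsiveFiniteRange v → ∃ ρ₁ : ℝ, 0 < ρ₁ ∧ ∀ ρ : ℝ, 0 < ρ → ρ < ρ₁ → ∀ᶠ N : ℕ in Filter.atTop, ∀ η : ℝ, 0 ≤ η → (∀ μ : ℝ, 0 < μ → (⨅ Ψ : Literature.MathematicalPhysics.QuantumManyBody.BoseGas.PeriodicTrialState N (Literature.MathematicalPhysics.QuantumManyBody.BoseGas.sideLength ρ N), Literature.MathematicalPhysics.QuantumManyBody.BoseGas.periodicEnergy v Ψ + ENNReal.ofReal μ * ((N : ENNReal) - Literature.MathematicalPhysics.QuantumManyBody.BoseGas.condensateOccupation N (Literature.MathematicalPhysics.QuantumManyBody.BoseGas.sideLength ρ N)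 Ψ.ψ)) ≤ Literature.MathematicalPhysics.QuantumManyBody.BoseGas.periodicGroundStateEnergy v N (Literature.MathematicalPhysics.QuantumManyBody.BoseGas.sideLength ρ N) + ENNReal.ofReal (μ * η * N)) → ∀ ε : ℝ, 0 < ε → ∃ δ : ENNReal, 0 < δ ∧ ∀ Ψ : Literature.MathematicalPhysics.QuantumManyBody.BoseGas.PeriodicTrialState N (Literature.MathematicalPhysics.QuantumManyBody.BoseGas.sideLength ρ N), Literature.MathematicalPhysics.QuantumManyBody.BoseGas.periodicEnergy v Ψ ≤ Literature.MathematicalPhysics.QuantumManyBody.BoseGas.periodicGroundStateEnergy v N (Literature.MathematicalPhysics.QuantumManyBody.BoseGas.sideLength ρ N) + δ → ENNReal.ofReal ((1 - η - ε) * N) ≤ Literature.MathematicalPhysics.QuantumManyBody.BoseGas.condensateOccupation N (Literature.MathematicalPhysics.QuantumManyBody.BoseGas.sideLength ρ N) Ψ.ψ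

/-- item stmt-AtomisticToContinuum-0827 · crux · rank 7 · open · by planner
why it might fail: the Dirichlet ground state lies a wall term ≫ the near-minimiser slack N/L² above E₀^per and interior restrictions are neither periodic nor of sharp N, so the periodic hypothesis may never fire; only the ENERGY transfer is in print (Robinson1976).
sources: LSSY2005, Robinson1976, BoccatoSeiringer2023, Junge2026
[crux] BoundaryTransferWeak (mode-free boundary-condition transfer, per potential): for each
repulsive finite-range v, PeriodicBEC(v) implies ∃ρ₀>0 ∀ρ∈(0,ρ₀) HasGroundStateBEC v ρ (Dirichlet
ground state, λ_max(γ) ≥ cN via condensateNumber). Not glue: near-minimiser slacks are O(N/L²) while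
Dirichlet/periodic energies differ by a boundary term ≫ N/L², so no energy-comparison proof;
expected route: Neumann bracketing of interior sub-boxes (−Δ_Dir ≥ ⊕−Δ_Neu, v ≥ 0) + a mode-free
criterion (λ_max ≥ tr γ²/N). Only the ENERGY analogue is in print (LiebSeiringerSolovejYngvason2005
Ch. 2 after (2.8)). v ≡ 0: hypothesis and conclusion both true. -/
@[route_item "route-AtomisticToContinuum-BECAmplitudeHierarchy"]
def BoundaryTransferWeak : Prop :=
  ∀ v : ℝ → ENNReal, Literature.MathematicalPhysics.QuantumManyBody.BoseGas.IsRepulsiveFiniteRange v → (∃ ρ₀ : ℝ, 0 < ρ₀ ∧ ∀ ρ : ℝ, 0 < ρ → ρ < ρ₀ → ∃ c : ℝ, 0 < c ∧ ∀ᶠ N : ℕ in Filter.atTop, ∃ δ : ENNReal, 0 < δ ∧ ∀ Ψ : Literature.MathematicalPhysics.QuantumManyBody.BoseGas.PeriodicTrialState N (Literature.MathematicalPhysics.QuantumManyBody.BoseGas.sideLength ρ N), Literature.MathematicalPhysics.QuantumManyBody.BoseGas.periodicEnergy v Ψ ≤ Literature.MathematicalPhysics.QuantumManyBody.BoseGas.periodicGroundStateEnergy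 v N (Literature.MathematicalPhysics.QuantumManyBody.BoseGas.sideLength ρ N) + δ → ENNReal.ofReal (c * N) ≤ Literature.MathematicalPhysics.QuantumManyBody.BoseGas.condensateOccupation N (Literature.MathematicalPhysics.QuantumManyBody.BoseGas.sideLength ρ N) Ψ.ψ) → ∃ ρ₀ : ℝ, 0 < ρ₀ ∧ ∀ ρ : ℝ, 0 < ρ → ρ < ρ₀ → Literature.MathematicalPhysics.QuantumManyBody.BoseGas.HasGroundStateBEC v ρ

/-- item stmt-AtomisticToContinuum-6869 · support · rank 9 · closed · moot by None · by planner
sources: Lieb1963, Jauslin2025, CarlenJauslinLieb2021, ReedSimonIV1978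
[support] (Lieb's starting identity, pinned version; card C3) for bounded repulsive finite-range v,
N, L > 0, μ ≥ 0 and ε > 0 there is δ > 0 such that every NON-NEGATIVE periodic trial state Ψ that is
a δ-near-minimiser of the pinned functional periodicEnergy + μ(N − condensateOccupation) satisfies
|E^(μ)(N,L)·∫_(cell^N)Ψ − ∫_(cell^N)(Σ_(i<j) v^per(x_i − x_j))Ψ| ≤ ε∫_(cell^N)Ψ (two ENNReal
inequalities): the pinned energy is the pair-energy of the amplitude gas, E^(μ)/N = ((N−1)/2V)∫v^per
g₂^(μ), with NO kinetic and NO pinning term (⟨1, Δψ⟩ = 0 on the torus and ⟨1, (1 − P_j)ψ⟩ = 0: the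
pin closes downward). Proof: uniqueness and positivity of the pinned ground state for μ ≥ 0,
L²-convergence of near-minimisers on the finite cell, ⟨1, H^(μ)ψ₀⟩ = E^(μ)⟨1, ψ₀⟩ with v^per
bounded. [difficulty: M] -/
@[route_item "route-AtomisticToContinuum-BECAmplitudeHierarchy"]
def AmplitudeEnergyIdentity : Prop :=
  ∀ v : ℝ → ENNReal, Literature.MathematicalPhysics.QuantumManyBody.BoseGas.IsRepulsiveFiniteRange v → (∃ M : NNReal, ∀ r : ℝ, v r ≤ (M : ENNReal)) → ∀ (N : ℕ) (L μ : ℝ), 0 < L → 0 ≤ μ → ∀ ε : ℝ, 0 < ε → ∃ δ : ENNReal, 0 < δ ∧ ∀ Ψ : Literature.MathematicalPhysics.QuantumManyBody.BoseGas.PeriodicTrialState N L, (∀ X, Ψ.ψ X = (‖Ψ.ψ X‖ : ℂ)) → Literature.MathematicalPhysics.QuantumManyBody.BoseGas.periodicEnergy v Ψ + ENNReal.ofReal μ * ((N : ENNReal) - Literature.MathematicalPhysics.QuantumManyBody.BoseGas.condensateOccupation N L Ψ.ψ) ≤ (⨅ Φ : Literature.MathematicalPhysics.QuantumManyBody.BoseGas.PeriodicTrialState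 N L, Literature.MathematicalPhysics.QuantumManyBody.BoseGas.periodicEnergy v Φ + ENNReal.ofReal μ * ((N : ENNReal) - Literature.MathematicalPhysics.QuantumManyBody.BoseGas.condensateOccupation N L Φ.ψ)) + δ → (⨅ Φ : Literature.MathematicalPhysics.QuantumManyBody.BoseGas.PeriodicTrialState N L, Literature.MathematicalPhysics.QuantumManyBody.BoseGas.periodicEnergy v Φ + ENNReal.ofReal μ * ((N : ENNReal) - Literature.MathematicalPhysics.QuantumManyBody.BoseGas.condensateOccupation N L Φ.ψ)) * (∫⁻ X in Literature.MathematicalPhysics.QuantumManyBody.BoseGas.cellN N L, (‖Ψ.ψ X‖₊ : ENNReal)) ≤ (∫⁻ X in Literature.MathematicalPhysics.QuantumManyBody.BoseGas.cellN N L, Literature.MathematicalPhysics.QuantumManyBody.BoseGas.periodicInteraction v L X * (‖Ψ.ψ X‖₊ : ENNReal)) + ENNReal.ofReal ε * (∫⁻ X in Literature.MathematicalPhysics.QuantumManyBody.BoseGas.cellN N L, (‖Ψ.ψ X‖₊ : ENNReal)) ∧ (∫⁻ X in Literature.MathematicalPhysics.QuantumManyBody.BoseGas.cellN N L, Literature.MathematicalPhysics.QuantumManyBody.BoseGas.periodicInteraction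 v L X * (‖Ψ.ψ X‖₊ : ENNReal)) ≤ (⨅ Φ : Literature.MathematicalPhysics.QuantumManyBody.BoseGas.PeriodicTrialState N L, Literature.MathematicalPhysics.QuantumManyBody.BoseGas.periodicEnergy v Φ + ENNReal.ofReal μ * ((N : ENNReal) - Literature.MathematicalPhysics.QuantumManyBody.BoseGas.condensateOccupation N L Φ.ψ)) * (∫⁻ X in Literature.MathematicalPhysics.QuantumManyBody.BoseGas.cellN N L, (‖Ψ.ψ X‖₊ : ENNReal)) + ENNReal.ofReal ε * (∫⁻ X in Literature.MathematicalPhysics.QuantumManyBody.BoseGas.cellN N L, (‖Ψ.ψ X‖₊ : ENNReal))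

/-- item stmt-AtomisticToContinuum-6870 · assembly · rank 1 · closed · moot by None · by planner
sources: LSSY2005, CarlenJauslinLieb2021
[assembly] PinnedSlopeBound → SlopeToCondensation → BoundaryTransferWeak → BoseEinsteinCondensation. -/
@[route_item "route-AtomisticToContinuum-BECAmplitudeHierarchy"]
def Assembly : Prop :=
  PinnedSlopeBound → SlopeToCondensation → BoundaryTransferWeak → Literature.MathematicalPhysics.QuantumManyBody.BoseGas.BoseEinsteinCondensation

end Summit.AtomisticToContinuum.BoseEinsteinCondensation.Theses.BECAmplitudeHierarchy
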